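import Summits.HubbardSuperconductivity.HubbardSuperconductivity.Theorems.NodalWardXYPerturbedXYOrderReduction
import Literature.Probability.LatticeModels.RotatorAngleCubeGinibre
import Literature.Analysis.Complex.LogDerivZeros
import Mathlib.Analysis.Complex.Schwarz

/-!
# `PerturbedXYOrder` (stmt-HubbardSuperconductivity-10739) — line `schwarz-inheritance`, stub `stub_chargedShiftInvariance`

Tools for the NEGATIVE stub `stub_chargedFieldPinching` (the charged-field variant of the crux is false — O(2)-invariance of the
tilt is load-bearing; `Theorems/PerturbedXYOrder/Negative/ChargedFieldPinching.lean`), over the vocabulary of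
`Theorems/NodalWardXYDefs.lean`:

* §A `cfp_log_norm_le_of_zeroFree` — complex analysis: `G` holomorphic and zero-free on `‖z‖ < R`, `G(0) = 1`, `G'(0) = 0`,
  `‖G‖ ≤ e^M` ⇒ `log ‖G(z)‖ ≤ 8M‖z‖²/R²` on `‖z‖ < R/2` (holomorphic logarithm `Literature.Analysis.Complex.exists_log_on_ball`,
  Mathlib's Borel–Carathéodory `Complex.borelCaratheodory_zero` and Schwarz lemma of order two
  `Complex.dist_le_mul_div_pow_of_mapsTo_ball_of_isLittleO`).
* §B `stub_chargedShiftInvariance` (registered stub) — **global rotation invariance** `θ ↦ θ + u` of the rotator state `w_J dθ` on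
  the angle cube `[0,2π]^Λ` against functions of the spins, via the tree's transfer `setIntegral_angleCube_comp_exp` to the torus
  `U(1)^Λ` and the invariance of its Haar measure (`integral_torusHaar_mul_right`); in particular the charged partition function
  `Z(η) = ∫_cube w_J e^{η Σ_x cos(θ_x + u)}` does not depend on `u`.
* §C consequences for `Z(η) = ∫_cube w_J e^{η Σ_x cos θ_x}`: growth `‖Z(η)‖ ≤ e^{‖η‖L³} Z(0)`, evenness (`u = π`), the quarter
  turns `Z(η) = ∫ w_J e^{±η Σ sin θ_x}` (`u = ∓π/2`), and the four-term identity
  `4 Z(t) = ∫ w_J (e^{tΦ} + e^{−tΦ} + e^{tΨ} + e^{−tΨ})` for real `t` (`Φ = Σ cos θ_x`, `Ψ = Σ sin θ_x`).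
-/

noncomputable section

namespace Summit.HubbardSuperconductivity.HubbardSuperconductivity.Theorems.PerturbedXYOrder

open MeasureTheory Literature.Probability.LatticeModels Metric Set
open Summit.HubbardSuperconductivity.HubbardSuperconductivity.Theses.NodalWardXY

/-! ### A. Complex analysis: an even zero-free function of bounded growth is pinched near the origin -/

/-- **Second-order Borel–Carathéodory pinching.** Let `G` be holomorphic and zero-free on the disc `‖z‖ < R`,
`G(0) = 1`, `G'(0) = 0`, and `‖G‖ ≤ e^M` there. Then `log ‖G(z)‖ ≤ 8 M ‖z‖² / R²` for `‖z‖ < R/2`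
(holomorphic logarithm `φ`, `Re φ ≤ M`; Borel–Carathéodory gives `‖φ‖ ≤ 2M` on the half disc; the Schwarz lemma
of order two, `φ(0) = φ'(0) = 0`, gives `‖φ(z)‖ ≤ 2M (2‖z‖/R)²`). [folklore] -/
theorem cfp_log_norm_le_of_zeroFree {G : ℂ → ℂ} {R M : ℝ} (hR : 0 < R) (hM : 0 < M)
    (hG : DifferentiableOn ℂ G (ball 0 R)) (hG0 : ∀ z ∈ ball (0 : ℂ) R, G z ≠ 0) (hG1 : G 0 = 1)
    (hbd : ∀ z ∈ ball (0 : ℂ) R, ‖G z‖ ≤ Real.exp M) (hder : deriv G 0 = 0) {z : ℂ} (hz : ‖z‖ < R / 2) :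
    Real.log ‖G z‖ ≤ 8 * M / R ^ 2 * ‖z‖ ^ 2 := by
  obtain ⟨φ, hφd, hφ0, hφder, hGexp⟩ := Literature.Analysis.Complex.exists_log_on_ball hG hG0
  have hGz : ∀ w ∈ ball (0 : ℂ) R, G w = Complex.exp (φ w) := fun w hw => by
    rw [hGexp w hw, hG1, one_mul]
  have hre : ∀ w ∈ ball (0 : ℂ) R, (φ w).re = Real.log ‖G w‖ := fun w hw => by
    rw [hGz w hw, Complex.norm_exp, Real.log_exp]
  have hmaps : MapsTo φ (ball 0 R) {w : ℂ | w.re ≤ M} := fun w hw => by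
    show (φ w).re ≤ M
    rw [hre w hw, Real.log_le_iff_le_exp (norm_pos_iff.2 (hG0 w hw))]
    exact hbd w hw
  have hR2 : 0 < R / 2 := half_pos hR
  -- Borel–Carathéodory on the half disc
  have hBC : MapsTo φ (ball 0 (R / 2)) (closedBall (φ 0) (2 * M)) := by
    intro w hw
    rw [mem_ball_zero_iff] at hw
    have hwR : w ∈ ball (0 : ℂ) R := mem_ball_zero_iff.2 (by linarith)
    have key := Complex.borelCaratheodory_zero hM hφd hmaps hR hwR hφ0
    rw [hφ0, mem_closedBall, dist_zero_right]
    calc ‖φ w‖ ≤ 2 * M * ‖w‖ / (R - ‖w‖) := key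
      _ ≤ 2 * M := by
          rw [div_le_iff₀ (by linarith)]
          nlinarith [norm_nonneg w]
  -- second-order Schwarz lemma
  have hφd2 : DifferentiableOn ℂ φ (ball 0 (R / 2)) := hφd.mono (ball_subset_ball (by linarith))
  have hderφ : HasDerivAt φ 0 0 := by
    have h := hφder 0 (mem_ball_self hR)
    rwa [hder, zero_div] at h
  have hn : (φ · - φ 0) =o[nhds (0 : ℂ)] (fun w => ‖w - 0‖ ^ 1) := by
    have h1 := hderφ.isLittleO
    simp only [smul_zero, sub_zero] at h1
    simp only [sub_zero, pow_one]
    exact h1.trans_isBigO (Asymptotics.isBigO_norm_right.2 (Asymptotics.isBigO_refl _ _))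
  have hzmem : z ∈ ball (0 : ℂ) (R / 2) := mem_ball_zero_iff.2 hz
  have key := Complex.dist_le_mul_div_pow_of_mapsTo_ball_of_isLittleO (n := 1) hφd2 hBC hn hzmem
  rw [hφ0, dist_zero_right, dist_zero_right] at key
  have hzR : z ∈ ball (0 : ℂ) R := mem_ball_zero_iff.2 (by linarith)
  calc Real.log ‖G z‖ = (φ z).re := (hre z hzR).symm
    _ ≤ ‖φ z‖ := Complex.re_le_norm _
    _ ≤ 2 * M * (‖z‖ / (R / 2)) ^ (1 + 1) := key
    _ = 8 * M / R ^ 2 * ‖z‖ ^ 2 := by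
        have hR0 : R ≠ 0 := hR.ne'
        rw [show (1 + 1 : ℕ) = 2 from rfl, div_pow, div_pow]
        field_simp
        ring

/-- The derivative at `0` of an even function vanishes. [folklore] -/
theorem cfp_deriv_zero_of_even {f : ℂ → ℂ} (hf : ∀ z, f (-z) = f z) : deriv f 0 = 0 := by
  have h : deriv (fun z => f (-z)) 0 = -deriv f (-0) := deriv_comp_neg (f := f) (x := 0)
  have hfun : (fun z => f (-z)) = f := funext hf
  rw [hfun, neg_zero] at h
  have : (2 : ℂ) * deriv f 0 = 0 := by linear_combination h
  simpa using this

/-! ### B. Constant-shift invariance of the rotator state on the angle cube -/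

variable {L : ℕ}

/-- The ferromagnetic weight `w_J` is the Ginibre weight of the bond characters `θ̄_x θ_{x+e_i}` at `e^{iθ}`. -/
theorem cfp_wJ_eq_ginibreWeight [NeZero L] (J : ℝ) (θ : TorusSite 3 L → ℝ) :
    wJ J θ = ((ginibreWeight (fun b : Bond L => diffChar b.1 (b.1 + Pi.single b.2 1)) (fun _ => J)
      (fun v => Circle.exp (θ v)) : ℝ) : ℂ) := by
  simp only [wJ, ginibreWeight, ginibreHamiltonian, reChar_diffChar_exp, Finset.mul_sum]

/-- **Global rotation invariance** of the rotator state in cube form: for a continuous function `F` of the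
spins `e^{iθ_x}`, `∫_cube w_J(θ) F(e^{i(θ+u)}) dθ = ∫_cube w_J(θ) F(e^{iθ}) dθ` (the weight depends on angle
differences only; transfer to the torus `U(1)^Λ` by `setIntegral_angleCube_comp_exp` and invariance of its
Haar measure). [folklore] -/
theorem cfp_setIntegral_shift [NeZero L] (J u : ℝ) {F : (TorusSite 3 L → Circle) → ℂ} (hF : Continuous F) :
    ∫ θ in cube L, wJ J θ * F (fun x => Circle.exp (θ x + u)) =
      ∫ θ in cube L, wJ J θ * F (fun x => Circle.exp (θ x)) := by
  set χ : Bond L → (TorusSite 3 L → Circle) →ₜ* Circle := fun b => diffChar b.1 (b.1 + Pi.single b.2 1)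
    with hχ
  set G : (TorusSite 3 L → Circle) → ℂ := fun z => ((ginibreWeight χ (fun _ => J) z : ℝ) : ℂ) * F z with hG
  have hGc : Continuous G := (Complex.continuous_ofReal.comp (continuous_ginibreWeight χ _)).mul hF
  set c : TorusSite 3 L → Circle := fun _ => Circle.exp u with hc
  have hGc' : Continuous fun z : TorusSite 3 L → Circle => G (z * c) :=
    hGc.comp (continuous_id.mul continuous_const)
  -- the weight is invariant under the global rotation `z ↦ z * c`
  have hwinv : ∀ z : TorusSite 3 L → Circle,
      ginibreWeight χ (fun _ => J) (z * c) = ginibreWeight χ (fun _ => J) z := by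
    intro z
    simp only [ginibreWeight, ginibreHamiltonian, reChar, hχ, diffChar_apply, Pi.mul_apply, hc]
    congr 1
    refine Finset.sum_congr rfl fun b _ => ?_
    rw [mul_inv, mul_mul_mul_comm, inv_mul_cancel, mul_one]
  have hL : ∀ θ : TorusSite 3 L → ℝ,
      wJ J θ * F (fun x => Circle.exp (θ x + u)) = G ((fun v => Circle.exp (θ v)) * c) := by
    intro θ
    have h1 : (fun x => Circle.exp (θ x + u)) = (fun v => Circle.exp (θ v)) * c := by
      funext x
      simp only [Pi.mul_apply, hc, Circle.exp_add]
    rw [h1, hG]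
    simp only
    rw [hwinv, cfp_wJ_eq_ginibreWeight]
  have hR : ∀ θ : TorusSite 3 L → ℝ,
      wJ J θ * F (fun x => Circle.exp (θ x)) = G (fun v => Circle.exp (θ v)) := by
    intro θ
    rw [hG]
    simp only
    rw [cfp_wJ_eq_ginibreWeight]
  have h1 := setIntegral_angleCube_comp_exp (V := TorusSite 3 L) (fun z => G (z * c)) hGc'.aestronglyMeasurable
  have h2 := setIntegral_angleCube_comp_exp (V := TorusSite 3 L) G hGc.aestronglyMeasurable
  rw [integral_torusHaar_mul_right] at h1
  calc ∫ θ in cube L, wJ J θ * F (fun x => Circle.exp (θ x + u))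
      = ∫ θ in cube L, G ((fun v => Circle.exp (θ v)) * c) := by
        refine integral_congr_ae (ae_of_all _ fun θ => hL θ)
    _ = (2 * Real.pi) ^ Fintype.card (TorusSite 3 L) • ∫ z, G z ∂torusHaar (TorusSite 3 L) := h1
    _ = ∫ θ in cube L, G (fun v => Circle.exp (θ v)) := h2.symm
    _ = ∫ θ in cube L, wJ J θ * F (fun x => Circle.exp (θ x)) := by
        refine integral_congr_ae (ae_of_all _ fun θ => (hR θ).symm)

/-- The spin `e^{iθ}` has real part `cos θ`. -/
theorem cfp_re_coe_exp (s : ℝ) : ((Circle.exp s : ℂ)).re = Real.cos s := by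
  rw [Circle.coe_exp, Complex.exp_ofReal_mul_I_re]

/-- **Shifted charged partition functions coincide**: for every `η ∈ ℂ` and `u ∈ ℝ`,
`∫_cube w_J e^{η Σ_x cos(θ_x + u)} = ∫_cube w_J e^{η Σ_x cos θ_x}`. -/
theorem cfp_Zfield_shift [NeZero L] (J u : ℝ) (η : ℂ) :
    ∫ θ in cube L, wJ J θ * Complex.exp (η * ∑ x : TorusSite 3 L, (Real.cos (θ x + u) : ℂ)) =
      ∫ θ in cube L, wJ J θ * Complex.exp (η * ∑ x : TorusSite 3 L, (Real.cos (θ x) : ℂ)) := by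
  set F : (TorusSite 3 L → Circle) → ℂ := fun z =>
    Complex.exp (η * ∑ x : TorusSite 3 L, (((z x : ℂ)).re : ℂ)) with hF
  have hFc : Continuous F := by
    refine Complex.continuous_exp.comp (continuous_const.mul ?_)
    refine continuous_finsetSum _ fun x _ => ?_
    exact Complex.continuous_ofReal.comp (Complex.continuous_re.comp
      (continuous_subtype_val.comp (continuous_apply x)))
  have key := cfp_setIntegral_shift (L := L) J u hFc
  simp only [hF, cfp_re_coe_exp] at key
  exact key



/-- STUB `stub_chargedShiftInvariance` (registered on stmt-HubbardSuperconductivity-10739, line `schwarz-inheritance`, rev 14):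
**the charged partition function is invariant under a global rotation of the field direction** — for all `J, u ∈ ℝ`, `L`, `η ∈ ℂ`,
`∫_cube w_J e^{η Σ_x cos(θ_x + u)} dθ = ∫_cube w_J e^{η Σ_x cos θ_x} dθ` (O(2)-invariance of the rotator state `w_J dθ`; Haar
invariance on `U(1)^Λ`). The tool behind the evenness / quarter-turn identities of the negative stub `stub_chargedFieldPinching`. [folklore] -/
theorem stub_chargedShiftInvariance :
    ∀ (J u : ℝ) (L : ℕ) [NeZero L] (η : ℂ),
      (∫ θ in cube L, wJ J θ * Complex.exp (η * ∑ x : TorusSite 3 L, (Real.cos (θ x + u) : ℂ))) =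
        ∫ θ in cube L, wJ J θ * Complex.exp (η * ∑ x : TorusSite 3 L, (Real.cos (θ x) : ℂ)) :=
  fun J u _ _ η => cfp_Zfield_shift J u η

/-! ### C. The charged partition function: growth, evenness, reality -/

/-- The number of sites is `L³`. -/
theorem cfp_card [NeZero L] : (Fintype.card (TorusSite 3 L) : ℝ) = (L : ℝ) ^ 3 := by
  simp only [Fintype.card_fun, Fintype.card_fin, ZMod.card]
  push_cast; ring


/-- `‖Σ_x cos θ_x‖ ≤ L³` (as a complex number). -/
theorem cfp_norm_sum_cos_le [NeZero L] (θ : TorusSite 3 L → ℝ) :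
    ‖∑ x : TorusSite 3 L, (Real.cos (θ x) : ℂ)‖ ≤ (L : ℝ) ^ 3 := by
  calc ‖∑ x : TorusSite 3 L, (Real.cos (θ x) : ℂ)‖ ≤ ∑ x : TorusSite 3 L, ‖(Real.cos (θ x) : ℂ)‖ :=
        norm_sum_le _ _
    _ ≤ ∑ _x : TorusSite 3 L, (1 : ℝ) := by
        gcongr with x _
        rw [Complex.norm_real, Real.norm_eq_abs]
        exact Real.abs_cos_le_one _
    _ = (L : ℝ) ^ 3 := by
        rw [Finset.sum_const, Finset.card_univ, nsmul_eq_mul, mul_one, cfp_card]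

/-- **Growth**: `‖∫_cube w_J e^{η Σ cos θ_x}‖ ≤ e^{‖η‖ L³} ∫_cube w_J`. -/
theorem cfp_norm_Zfield_le [NeZero L] (J : ℝ) (η : ℂ) :
    ‖∫ θ in cube L, wJ J θ * Complex.exp (η * ∑ x : TorusSite 3 L, (Real.cos (θ x) : ℂ))‖ ≤
      Real.exp (‖η‖ * (L : ℝ) ^ 3) *
        ∫ θ in cube L, Real.exp (J * ∑ b : Bond L, Real.cos (θ (b.1 + Pi.single b.2 1) - θ b.1)) := by
  rw [← integral_const_mul]
  refine norm_integral_le_of_norm_le (((continuous_xyWeight J).continuousOn.integrableOn_compact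
    ent_isCompact_cube).const_mul _) (ae_of_all _ fun θ => ?_)
  rw [norm_mul]
  have hw : ‖wJ J θ‖ = Real.exp (J * ∑ b : Bond L, Real.cos (θ (b.1 + Pi.single b.2 1) - θ b.1)) := by
    unfold wJ; rw [Complex.norm_real, Real.norm_eq_abs, Real.abs_exp]
  rw [hw, mul_comm]
  refine mul_le_mul_of_nonneg_right ?_ (Real.exp_pos _).le
  refine (Complex.norm_exp_le_exp_norm _).trans (Real.exp_le_exp.2 ?_)
  rw [norm_mul]
  exact mul_le_mul_of_nonneg_left (cfp_norm_sum_cos_le θ) (norm_nonneg _)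

/-- **Evenness** (`θ ↦ θ + π`): `∫ w_J e^{−η Σ cos θ_x} = ∫ w_J e^{η Σ cos θ_x}`. -/
theorem cfp_Zfield_neg [NeZero L] (J : ℝ) (η : ℂ) :
    ∫ θ in cube L, wJ J θ * Complex.exp (-η * ∑ x : TorusSite 3 L, (Real.cos (θ x) : ℂ)) =
      ∫ θ in cube L, wJ J θ * Complex.exp (η * ∑ x : TorusSite 3 L, (Real.cos (θ x) : ℂ)) := by
  rw [← cfp_Zfield_shift J Real.pi η]
  refine integral_congr_ae (ae_of_all _ fun θ => ?_)
  simp only [Real.cos_add_pi, Complex.ofReal_neg, Finset.sum_neg_distrib, mul_neg, neg_mul]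

/-- **Quarter turn** (`θ ↦ θ − π/2`): `∫ w_J e^{η Σ sin θ_x} = ∫ w_J e^{η Σ cos θ_x}`. -/
theorem cfp_Zfield_sin [NeZero L] (J : ℝ) (η : ℂ) :
    ∫ θ in cube L, wJ J θ * Complex.exp (η * ∑ x : TorusSite 3 L, (Real.sin (θ x) : ℂ)) =
      ∫ θ in cube L, wJ J θ * Complex.exp (η * ∑ x : TorusSite 3 L, (Real.cos (θ x) : ℂ)) := by
  rw [← cfp_Zfield_shift J (-(Real.pi / 2)) η]
  refine integral_congr_ae (ae_of_all _ fun θ => ?_)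
  simp only [← sub_eq_add_neg, Real.cos_sub_pi_div_two]

/-- **Quarter turn** (`θ ↦ θ + π/2`): `∫ w_J e^{−η Σ sin θ_x} = ∫ w_J e^{η Σ cos θ_x}`. -/
theorem cfp_Zfield_neg_sin [NeZero L] (J : ℝ) (η : ℂ) :
    ∫ θ in cube L, wJ J θ * Complex.exp (-η * ∑ x : TorusSite 3 L, (Real.sin (θ x) : ℂ)) =
      ∫ θ in cube L, wJ J θ * Complex.exp (η * ∑ x : TorusSite 3 L, (Real.cos (θ x) : ℂ)) := by
  rw [← cfp_Zfield_shift J (Real.pi / 2) η]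
  refine integral_congr_ae (ae_of_all _ fun θ => ?_)
  simp only [Real.cos_add_pi_div_two, Complex.ofReal_neg, Finset.sum_neg_distrib, mul_neg, neg_mul]

/-- Real exponentials of real sums, as complex numbers. -/
theorem cfp_cexp_real [NeZero L] (t : ℝ) (f : TorusSite 3 L → ℝ) :
    Complex.exp ((t : ℂ) * ∑ x : TorusSite 3 L, (f x : ℂ)) = ((Real.exp (t * ∑ x, f x) : ℝ) : ℂ) := by
  rw [Complex.ofReal_exp]
  push_cast
  rfl

/-- **Reality and the four-term identity**: for real `t`,
`4 ∫ w_J e^{t Σ cos θ_x} = ∫ w_J (e^{tΦ} + e^{−tΦ} + e^{tΨ} + e^{−tΨ})` (a real integral). -/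
theorem cfp_four_Zfield [NeZero L] (J t : ℝ) :
    4 * ∫ θ in cube L, wJ J θ * Complex.exp ((t : ℂ) * ∑ x : TorusSite 3 L, (Real.cos (θ x) : ℂ)) =
      ((∫ θ in cube L, Real.exp (J * ∑ b : Bond L, Real.cos (θ (b.1 + Pi.single b.2 1) - θ b.1)) *
        (Real.exp (t * ∑ x, Real.cos (θ x)) + Real.exp (-(t * ∑ x, Real.cos (θ x))) +
          Real.exp (t * ∑ x, Real.sin (θ x)) + Real.exp (-(t * ∑ x, Real.sin (θ x)))) : ℝ) : ℂ) := by
  -- integrability of the four charged integrands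
  have hint : ∀ (c : ℂ) (g : ℝ → ℝ), Continuous g →
      Integrable (fun θ : TorusSite 3 L → ℝ => wJ J θ * Complex.exp (c * ∑ x : TorusSite 3 L, (g (θ x) : ℂ)))
        (volume.restrict (cube L)) := by
    intro c g hg
    refine Continuous.continuousOn ?_ |>.integrableOn_compact ent_isCompact_cube
    refine (ent_continuous_wJ J).mul (Complex.continuous_exp.comp (continuous_const.mul ?_))
    exact continuous_finsetSum _ fun x _ => Complex.continuous_ofReal.comp (hg.comp (continuous_apply x))
  have h1 := hint (t : ℂ) Real.cos Real.continuous_cos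
  have h2 := hint (-(t : ℂ)) Real.cos Real.continuous_cos
  have h3 := hint (t : ℂ) Real.sin Real.continuous_sin
  have h4 := hint (-(t : ℂ)) Real.sin Real.continuous_sin
  have h12 : Integrable (fun θ : TorusSite 3 L → ℝ =>
      wJ J θ * Complex.exp ((t : ℂ) * ∑ x : TorusSite 3 L, (Real.cos (θ x) : ℂ)) +
      wJ J θ * Complex.exp (-(t : ℂ) * ∑ x : TorusSite 3 L, (Real.cos (θ x) : ℂ))) (volume.restrict (cube L)) :=
    h1.add h2
  have h123 : Integrable (fun θ : TorusSite 3 L → ℝ =>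
      wJ J θ * Complex.exp ((t : ℂ) * ∑ x : TorusSite 3 L, (Real.cos (θ x) : ℂ)) +
      wJ J θ * Complex.exp (-(t : ℂ) * ∑ x : TorusSite 3 L, (Real.cos (θ x) : ℂ)) +
      wJ J θ * Complex.exp ((t : ℂ) * ∑ x : TorusSite 3 L, (Real.sin (θ x) : ℂ))) (volume.restrict (cube L)) :=
    h12.add h3
  have e1 := cfp_Zfield_neg (L := L) J (t : ℂ)
  have e2 := cfp_Zfield_sin (L := L) J (t : ℂ)
  have e3 := cfp_Zfield_neg_sin (L := L) J (t : ℂ)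
  -- real and complex exponentials
  have hpos : ∀ (g : ℝ → ℝ) (θ : TorusSite 3 L → ℝ),
      Complex.exp ((t : ℂ) * ∑ x : TorusSite 3 L, (g (θ x) : ℂ)) = ((Real.exp (t * ∑ x, g (θ x)) : ℝ) : ℂ) := by
    intro g θ
    rw [Complex.ofReal_exp]
    push_cast
    rfl
  have hneg : ∀ (g : ℝ → ℝ) (θ : TorusSite 3 L → ℝ),
      Complex.exp (-(t : ℂ) * ∑ x : TorusSite 3 L, (g (θ x) : ℂ)) =
        ((Real.exp (-(t * ∑ x, g (θ x))) : ℝ) : ℂ) := by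
    intro g θ
    rw [Complex.ofReal_exp]
    congr 1
    push_cast
    ring
  calc 4 * ∫ θ in cube L, wJ J θ * Complex.exp ((t : ℂ) * ∑ x : TorusSite 3 L, (Real.cos (θ x) : ℂ))
      = (∫ θ in cube L, wJ J θ * Complex.exp ((t : ℂ) * ∑ x : TorusSite 3 L, (Real.cos (θ x) : ℂ))) +
        (∫ θ in cube L, wJ J θ * Complex.exp (-(t : ℂ) * ∑ x : TorusSite 3 L, (Real.cos (θ x) : ℂ))) +
        (∫ θ in cube L, wJ J θ * Complex.exp ((t : ℂ) * ∑ x : TorusSite 3 L, (Real.sin (θ x) : ℂ))) +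
        (∫ θ in cube L, wJ J θ * Complex.exp (-(t : ℂ) * ∑ x : TorusSite 3 L, (Real.sin (θ x) : ℂ))) := by
        rw [e1, e2, e3]; ring
    _ = ∫ θ in cube L, (wJ J θ * Complex.exp ((t : ℂ) * ∑ x : TorusSite 3 L, (Real.cos (θ x) : ℂ)) +
          wJ J θ * Complex.exp (-(t : ℂ) * ∑ x : TorusSite 3 L, (Real.cos (θ x) : ℂ)) +
          wJ J θ * Complex.exp ((t : ℂ) * ∑ x : TorusSite 3 L, (Real.sin (θ x) : ℂ)) +
          wJ J θ * Complex.exp (-(t : ℂ) * ∑ x : TorusSite 3 L, (Real.sin (θ x) : ℂ))) := by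
        rw [integral_add h123 h4, integral_add h12 h3, integral_add h1 h2]
    _ = _ := by
        rw [← integral_complex_ofReal]
        refine integral_congr_ae (ae_of_all _ fun θ => ?_)
        dsimp only
        rw [hpos Real.cos θ, hpos Real.sin θ, hneg Real.cos θ, hneg Real.sin θ]
        unfold wJ
        push_cast
        ring

end Summit.HubbardSuperconductivity.HubbardSuperconductivity.Theorems.PerturbedXYOrder

end
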